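import Summits.ResolutionOfSingularities.ResolutionOfSingularities.Theorems.FrobeniusLadderFInjectiveMacaulayficationWildPinchFan
import HarnessLib

/-!
# The characteristic-3 pinch `y³ + ut²y + ut³`: strict transforms along the singular line and primality
# (crux `FInjectiveMacaulayfication` stmt-ResolutionOfSingularities-15315, chain w45a, door v30; second specimen for the line-centre engine)

[OURS · L1 W4.5a · res-L1-w45a-lead-1 gen 5] Support file (`--supports stmt-ResolutionOfSingularities-15315 --as helper`); NOT a
statement of any manuscript; AI-written, weaker than expert review.

The specimen `f = y³ + ut²y + ut³ ∈ k[y,u,t]` (`(y,u,t) = (X₀,X₁,X₂)`), `char k = 3`: an Artin–Schreier-type pinch, monic of degree `3` in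
`y`, non-normal along the line `D = V(y,t) = Sing V(f)`. This file is the polynomial half of its #4β certificate (the other half is one
call to `LineCentreEngine.closedCentreExists_of_charts`): on the two charts of `WildPinchClosedCentre.Fan02of3`,
`θ₀ f = y³·g₀`, `g₀ = 1 + uT² + uT³` and `θ₁ f = t³·g₁`, `g₁ = S³ + uS + u`; the partials `∂g₀/∂T = 2uT`, `∂g₁/∂u = S + 1`,
`∂f/∂y = ut²`, `∂f/∂u = t²y + t³` in characteristic `3`; no variable divides `g₀`, `g₁`; and `f` is prime dividing no variable
(Eisenstein at `(u) ⊂ k[u,t]`, exactly as `WildPinchClosedCentre.prime_wildPinch`). [folklore]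
-/

-- single-problem summit: the doubled namespace component is forced
set_option linter.dupNamespace false

noncomputable section

namespace Summit.ResolutionOfSingularities.ResolutionOfSingularities.Theorems.FInjectiveMacaulayfication.AS3Pinch

open MvPolynomial
open Summit.ResolutionOfSingularities.ResolutionOfSingularities.Theorems.FInjectiveMacaulayfication
open Summit.ResolutionOfSingularities.ResolutionOfSingularities.Theorems.FInjectiveMacaulayfication.WildPinchClosedCentre

/-- **Chart `y` (`t ↦ yT`): `θ₀ f = y³ · (1 + uT² + uT³)`.** [folklore] -/
theorem theta_zero (k : Type) [Field k] (f : MvPolynomial (Fin 3) k) (hf : f = X 0 ^ 3 + X 1 * X 2 ^ 2 * X 0 + X 1 * X 2 ^ 3) :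
    aeval (fun j : Fin 3 => ∏ i : Fin 3, (X i : MvPolynomial (Fin 3) k) ^ Fan02of3.V 0 i j) f =
      monomial (Finsupp.single (Fan02of3.jc 0) 3) (1 : k) * (1 + X 1 * X 2 ^ 2 + X 1 * X 2 ^ 3) := by
  rw [hf, show Fan02of3.jc 0 = (0 : Fin 3) from rfl, ← X_pow_eq_monomial]
  simp only [map_add, map_mul, map_pow, aeval_X, Fin.prod_univ_three, Fan02of3.V]
  simp
  ring

/-- **Chart `t` (`y ↦ tS`): `θ₁ f = t³ · (S³ + uS + u)`.** [folklore] -/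
theorem theta_one (k : Type) [Field k] (f : MvPolynomial (Fin 3) k) (hf : f = X 0 ^ 3 + X 1 * X 2 ^ 2 * X 0 + X 1 * X 2 ^ 3) :
    aeval (fun j : Fin 3 => ∏ i : Fin 3, (X i : MvPolynomial (Fin 3) k) ^ Fan02of3.V 1 i j) f =
      monomial (Finsupp.single (Fan02of3.jc 1) 3) (1 : k) * (X 0 ^ 3 + X 1 * X 0 + X 1) := by
  rw [hf, show Fan02of3.jc 1 = (2 : Fin 3) from rfl, ← X_pow_eq_monomial]
  simp only [map_add, map_mul, map_pow, aeval_X, Fin.prod_univ_three, Fan02of3.V]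
  simp
  ring

/-- Both strict transforms packaged over `c : Fin 2`. -/
theorem theta (k : Type) [Field k] (f : MvPolynomial (Fin 3) k) (hf : f = X 0 ^ 3 + X 1 * X 2 ^ 2 * X 0 + X 1 * X 2 ^ 3) :
    ∀ c : Fin 2, aeval (fun j : Fin 3 => ∏ i : Fin 3, (X i : MvPolynomial (Fin 3) k) ^ Fan02of3.V c i j) f =
      monomial (Finsupp.single (Fan02of3.jc c) ((fun _ : Fin 2 => 3) c)) (1 : k) *
        (![1 + X 1 * X 2 ^ 2 + X 1 * X 2 ^ 3, X 0 ^ 3 + X 1 * X 0 + X 1] c) := by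
  intro c
  fin_cases c
  · exact theta_zero k f hf
  · exact theta_one k f hf

/-- No variable divides either strict transform. [folklore] -/
theorem hcop (k : Type) [Field k] : ∀ (c : Fin 2) (i : Fin 3),
    ¬ (X i ∣ (![1 + X 1 * X 2 ^ 2 + X 1 * X 2 ^ 3, X 0 ^ 3 + X 1 * X 0 + X 1] c : MvPolynomial (Fin 3) k)) := by
  intro c i
  fin_cases c
  · exact not_X_dvd_of_eval (fun _ => 0) i rfl _ (by simp)
  · fin_cases i
    · exact not_X_dvd_of_eval ![0, 1, 0] 0 rfl _ (by simp)
    · exact not_X_dvd_of_eval ![1, 0, 0] 1 rfl _ (by simp)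
    · exact not_X_dvd_of_eval ![1, 0, 0] 2 rfl _ (by simp)

/-- `(3 : k[X]) = 0` and `2 · 2 = 1` in characteristic `3`. -/
theorem three_eq_zero (k : Type) [Field k] [CharP k 3] {n : ℕ} :
    (3 : MvPolynomial (Fin n) k) = 0 ∧ (2 : MvPolynomial (Fin n) k) * 2 = 1 := by
  have h := CharP.cast_eq_zero (MvPolynomial (Fin n) k) 3
  have h3 : (3 : MvPolynomial (Fin n) k) = 0 := by simpa using h
  refine ⟨h3, ?_⟩
  have h4 : (2 : MvPolynomial (Fin n) k) * 2 = 3 + 1 := by norm_num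
  rw [h4, h3, zero_add]

/-- `∂g₀/∂T = 2uT` in characteristic `3`. [folklore] -/
theorem pderiv_two_g0 (k : Type) [Field k] [CharP k 3] :
    pderiv 2 (1 + X 1 * X 2 ^ 2 + X 1 * X 2 ^ 3 : MvPolynomial (Fin 3) k) = 2 * (X 1 * X 2) := by
  have h : pderiv 2 (1 + X 1 * X 2 ^ 2 + X 1 * X 2 ^ 3 : MvPolynomial (Fin 3) k) = 2 * (X 1 * X 2) + 3 * (X 1 * X 2 ^ 2) := by
    simp only [map_add, pderiv_one, pderiv_mul, pderiv_pow, pderiv_X_self, pderiv_X_of_ne (show (1 : Fin 3) ≠ 2 by decide)]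
    push_cast
    ring
  rw [h, (three_eq_zero k).1, zero_mul, add_zero]

/-- `∂g₁/∂u = S + 1`. [folklore] -/
theorem pderiv_one_g1 (k : Type) [Field k] :
    pderiv 1 (X 0 ^ 3 + X 1 * X 0 + X 1 : MvPolynomial (Fin 3) k) = X 0 + 1 := by
  simp only [map_add, pderiv_mul, pderiv_pow, pderiv_X_self, pderiv_X_of_ne (show (0 : Fin 3) ≠ 1 by decide)]
  push_cast
  ring

/-- `∂f/∂y = ut²` in characteristic `3`. [folklore] -/
theorem pderiv_zero_f (k : Type) [Field k] [CharP k 3] (f : MvPolynomial (Fin 3) k)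
    (hf : f = X 0 ^ 3 + X 1 * X 2 ^ 2 * X 0 + X 1 * X 2 ^ 3) : pderiv 0 f = X 1 * X 2 ^ 2 := by
  have h : pderiv 0 f = 3 * X 0 ^ 2 + X 1 * X 2 ^ 2 := by
    rw [hf]
    simp only [map_add, pderiv_mul, pderiv_pow, pderiv_X_self, pderiv_X_of_ne (show (1 : Fin 3) ≠ 0 by decide),
      pderiv_X_of_ne (show (2 : Fin 3) ≠ 0 by decide)]
    push_cast
    ring
  rw [h, (three_eq_zero k).1, zero_mul, zero_add]

/-- `∂f/∂u = t²y + t³`. [folklore] -/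
theorem pderiv_one_f (k : Type) [Field k] (f : MvPolynomial (Fin 3) k)
    (hf : f = X 0 ^ 3 + X 1 * X 2 ^ 2 * X 0 + X 1 * X 2 ^ 3) : pderiv 1 f = X 2 ^ 2 * X 0 + X 2 ^ 3 := by
  rw [hf]
  simp only [map_add, pderiv_mul, pderiv_pow, pderiv_X_self, pderiv_X_of_ne (show (0 : Fin 3) ≠ 1 by decide),
    pderiv_X_of_ne (show (2 : Fin 3) ≠ 1 by decide)]
  push_cast
  ring

/-- **`f = y³ + ut²y + ut³` is prime and divides no variable** (any field): under `k[X₀,X₁,X₂] ≃ k[Y₀,Y₁][T]` (`X₀ ↦ T`),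
`f ↦ T³ + Y₀Y₁²·T + Y₀Y₁³`, a monic cubic Eisenstein at the prime `(Y₀)`. [folklore] -/
theorem prime_AS3 (k : Type) [Field k] (f : MvPolynomial (Fin 3) k)
    (hf : f = X 0 ^ 3 + X 1 * X 2 ^ 2 * X 0 + X 1 * X 2 ^ 3) : Prime f ∧ ∀ j : Fin 3, ¬ (f ∣ X j) := by
  set e : MvPolynomial (Fin 3) k ≃+* Polynomial (MvPolynomial (Fin 2) k) := (finSuccEquiv k 2).toRingEquiv with he_def
  have he0 : e (X 0) = Polynomial.X := finSuccEquiv_X_zero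
  have he1 : e (X 1) = Polynomial.C (X 0) := finSuccEquiv_X_succ (j := 0)
  have he2 : e (X 2) = Polynomial.C (X 1) := finSuccEquiv_X_succ (j := 1)
  set q : Polynomial (MvPolynomial (Fin 2) k) :=
    Polynomial.C (X 0 * X 1 ^ 2) * Polynomial.X + Polynomial.C (X 0 * X 1 ^ 3) with hq
  have hef : e f = Polynomial.X ^ 3 + q := by
    rw [hf, hq]
    simp only [map_add, map_mul, map_pow, he0, he1, he2]
    ring
  have hqdeg : q.degree < (3 : ℕ) := lt_of_le_of_lt Polynomial.degree_linear_le (by exact_mod_cast (by norm_num : 1 < 3))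
  have hmonic : (e f).Monic := by rw [hef]; exact Polynomial.monic_X_pow_add hqdeg
  have hnat : (e f).natDegree = 3 := by
    rw [hef, Polynomial.natDegree_add_eq_left_of_degree_lt, Polynomial.natDegree_X_pow]
    rwa [Polynomial.degree_X_pow]
  have hc0 : (e f).coeff 0 = X 0 * X 1 ^ 3 := by
    rw [hef, hq, Polynomial.coeff_add, Polynomial.coeff_add, Polynomial.coeff_X_pow, Polynomial.coeff_C_mul_X,
      Polynomial.coeff_C_zero]
    simp
  have hc1 : (e f).coeff 1 = X 0 * X 1 ^ 2 := by
    rw [hef, hq, Polynomial.coeff_add, Polynomial.coeff_add, Polynomial.coeff_X_pow, Polynomial.coeff_C_mul_X,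
      Polynomial.coeff_C]
    simp
  have hc2 : (e f).coeff 2 = 0 := by
    rw [hef, hq, Polynomial.coeff_add, Polynomial.coeff_add, Polynomial.coeff_X_pow, Polynomial.coeff_C_mul_X,
      Polynomial.coeff_C]
    simp
  -- Eisenstein at `𝓟 = (Y₀)`
  set 𝓟 : Ideal (MvPolynomial (Fin 2) k) := Ideal.span {X 0} with h𝓟
  have hP : 𝓟.IsPrime := (Ideal.span_singleton_prime (X_ne_zero (0 : Fin 2))).mpr X_prime
  have hE : (e f).IsEisensteinAt 𝓟 :=
    { leading := by
        rw [hmonic.leadingCoeff]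
        exact fun h1 => hP.ne_top ((Ideal.eq_top_iff_one _).mpr h1)
      mem := by
        intro i hi
        rw [hnat] at hi
        interval_cases i
        · rw [hc0]; exact Ideal.mem_span_singleton.mpr (dvd_mul_right _ _)
        · rw [hc1]; exact Ideal.mem_span_singleton.mpr (dvd_mul_right _ _)
        · rw [hc2]; exact zero_mem _
      notMem := by
        rw [hc0, h𝓟, Ideal.span_singleton_pow, Ideal.mem_span_singleton, pow_two]
        intro h
        have h1 : (X 0 : MvPolynomial (Fin 2) k) ∣ X 1 ^ 3 := (mul_dvd_mul_iff_left (X_ne_zero (0 : Fin 2))).mp h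
        have h2 : (X 0 : MvPolynomial (Fin 2) k) ∣ X 1 := X_prime.dvd_of_dvd_pow h1
        exact absurd (X_dvd_X.mp h2) (by decide) }
  have hirr : Irreducible (e f) := hE.irreducible hP hmonic.isPrimitive (by rw [hnat]; exact Nat.succ_pos 2)
  have hprime : Prime f := (MulEquiv.prime_iff e).mp hirr.prime
  have hdeg : ∀ j : Fin 3, (e (X j)).natDegree ≤ 1 := by
    intro j
    fin_cases j
    · simp [he0]
    · simp [he1]
    · simp [he2]
  refine ⟨hprime, fun j hdvd => ?_⟩
  have h1 : e f ∣ e (X j) := map_dvd e hdvd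
  have hne : e (X j) ≠ 0 := by rw [map_ne_zero_iff e e.injective]; exact X_ne_zero j
  have h2 := Polynomial.natDegree_le_of_dvd h1 hne
  rw [hnat] at h2
  have h3 := hdeg j
  omega

end Summit.ResolutionOfSingularities.ResolutionOfSingularities.Theorems.FInjectiveMacaulayfication.AS3Pinch
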